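import Summits.QuantumFields.YangMills.Theorems.FlatTubeReductionDecimationReadingBase
import HarnessLib

/-!
# Route `FlatTubeReduction`, crux `PinnedUnitStepEx` (stmt-QuantumFields-27561), stub `stub_smearVarPosGS1` — E2d-2a′: the base-reading reduction
# at every lattice size (the degenerate coarse torus `L' = 1` included)

Seat ym-line-fcl-p3 g9 (2026-08-28).  `esPart_reading_eq_base` (p640049) assumes `2 ≤ L'` (two distinct coarse sites along a line are used to place
the one-site gauge transformation).  On the one-site coarse torus `L' = 1` every coarse link is a loop, the reading of a loop through the decoder
`v = e_j` is the conjugate `ba` of the base reading `ab`, i.e. a CONSTANT gauge transformation, and an admissible decoder with two non-zero components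
forces `R₁ = ∅`; so the reduction holds there too (`esPart_reading_eq_base_one`).  ★ `esPart_reading_eq_base'` = both cases.  R2b1 RECORD rung.
-/

set_option autoImplicit false

noncomputable section

namespace Summit.QuantumFields.YangMills.Theorems.FlatTubeReduction.Decimation

open MeasureTheory Finset Function
open Literature.MathematicalPhysics.QuantumFieldTheory (Site Edge GaugeConfig gaugeTransform haarProbability)
open Literature.MathematicalPhysics.QuantumFieldTheory.TorusTranslation
open Summit.QuantumFields.YangMills.Theorems.FemtoCutoffLadder.Thinning
open Literature.Probability.Independence.Hoeffding

variable {G : Type*} [Group G] [MeasurableSpace G] [TopologicalSpace G] [IsTopologicalGroup G] [CompactSpace G] [BorelSpace G]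

omit [TopologicalSpace G] [IsTopologicalGroup G] [CompactSpace G] [BorelSpace G] in
/-- Reading on the one-site coarse torus: every coarse link is doubled, `W_{m̄,v}(U)(x,i) = U(−v, i)·U(−v + e_i, i)`. [folklore] -/
theorem reading_one (mbar : Site 3 1) (v : Site 3 2) (U : GaugeConfig 3 2 G) (x : Site 3 1) (i : Fin 3) :
    thin 1 (torusConfigShift v U) (x - mbar, i) = U (-v, i) * U (-v + Pi.single i 1, i) := by
  rw [reading_apply]
  have h0 : (x - mbar) i = 0 := Subsingleton.elim _ _
  have hs : thinSite 2 (x - mbar) = (0 : Site 3 2) := by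
    funext k; simp only [thinSite, Pi.zero_apply]
    rw [Subsingleton.elim ((x - mbar) k) 0]
    exact (thinCoord_eq_zero_iff (L := 2) (L' := 1) (by omega) 0).2 rfl
  rw [if_pos h0, hs, zero_sub, zero_add, ← sub_eq_neg_add, ← neg_add_eq_sub]

/-- **The reduction on the one-site coarse torus.** [folklore] -/
theorem esPart_reading_eq_base_one {g : GaugeConfig 3 1 G → ℝ} (hg : Measurable g)
    (hGI : ∀ (k : Site 3 1 → G) (W : GaugeConfig 3 1 G), g (gaugeTransform k W) = g W)
    (R₁ : Finset (Edge 3 1)) (mbar : Site 3 1) (v : Site 3 2)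
    (hadm : ∀ j : Fin 3, (∃ m : ℕ, mbar j = (m : ZMod 1) ∧ v j = -((m : ℕ) : ZMod 2) ∧
            ∀ t : ℕ, t < m → ∀ e ∈ R₁, e.1 j = 1 + (t : ZMod 1) → e.2 = j) ∨
          (mbar j = 0 ∧ shiftLinks (Pi.single j (1 : ZMod 1) : Site 3 1) R₁ = R₁ ∧ ∀ e ∈ R₁, e.2 = j))
    (U : GaugeConfig 3 2 G) :
    esPart (haarProbability G) R₁ g (fun e : Edge 3 1 => thin 1 (torusConfigShift v U) (e.1 - mbar, e.2)) =
      esPart (haarProbability G) R₁ g (thin 1 U) := by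
  -- a non-zero decoder component `v_j` forces all links of `R₁` to have direction `j`
  have hdir : ∀ j : Fin 3, v j ≠ 0 → ∀ e ∈ R₁, e.2 = j := by
    intro j hvj e he
    rcases hadm j with ⟨m, -, hv, hsl⟩ | ⟨-, -, htr⟩
    · have hm : 0 < m := by
        by_contra h0
        have : m = 0 := by omega
        subst this; simp at hv; exact hvj hv
      exact hsl 0 hm e he (Subsingleton.elim _ _)
    · exact htr e he
  have hbase : ∀ e : Edge 3 1, thin 1 U e = U (0, e.2) * U (Pi.single e.2 1, e.2) := by
    intro e
    have := reading_one (G := G) 0 0 U e.1 e.2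
    simp only [sub_zero, neg_zero, zero_add] at this
    rw [Summit.QuantumFields.YangMills.Theorems.FemtoTransferGap.torusConfigShift_zero] at this
    exact this
  by_cases hv0 : v = 0
  · subst hv0
    congr 1
    funext e
    rw [reading_one, hbase e, neg_zero, zero_add]
  · -- some component is non-zero
    obtain ⟨j, hj⟩ : ∃ j, v j ≠ 0 := by
      by_contra h; push Not at h; exact hv0 (funext h)
    by_cases htwo : ∃ j', j' ≠ j ∧ v j' ≠ 0
    · -- two non-zero components: `R₁` has only `j`-links and only `j'`-links, hence is empty
      obtain ⟨j', hjj', hj'⟩ := htwo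
      have hR : R₁ = ∅ := by
        ext e
        simp only [Finset.notMem_empty, iff_false]
        intro he
        exact hjj' ((hdir j' hj' e he).symm.trans (hdir j hj e he))
      subst hR
      -- the empty part is a constant
      unfold esPart
      simp [condAvg_univ]
    · push Not at htwo
      -- `v = e_j` (in `ℤ/2`, the non-zero value is `1`)
      have hv1 : v j = 1 := by
        have : ∀ z : ZMod 2, z ≠ 0 → z = 1 := by decide
        exact this _ hj
      have hv : v = Pi.single j 1 := by
        funext k
        by_cases hk : k = j
        · subst hk; simp [hv1]
        · simp only [Pi.single_apply, if_neg hk]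
          by_contra hne; exact absurd (htwo k hk) (by simpa using hne)
      subst hv
      -- constant gauge transformation `k ≡ U(e_j, j)` conjugates the base loop reading into the shifted one
      refine esPart_eq_of_gauge_eqOn hg hGI R₁ (fun _ => U (Pi.single j 1, j)) fun e he => ?_
      have hej : e.2 = j := hdir j hj e he
      obtain ⟨x, i⟩ := e
      simp only at hej
      subst hej
      rw [reading_one, gaugeTransform, hbase]
      have h2 : -(Pi.single i (1 : ZMod 2)) = (Pi.single i 1 : Site 3 2) := by
        funext k; simp only [Pi.neg_apply, Pi.single_apply]; split_ifs <;> decide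
      rw [h2, ← two_smul ℕ (Pi.single i (1 : ZMod 2) : Site 3 2)]
      have h3 : (2 : ℕ) • (Pi.single i (1 : ZMod 2) : Site 3 2) = 0 := by
        funext k; simp only [Pi.smul_apply, Pi.single_apply, Pi.zero_apply]; split_ifs <;> decide
      rw [h3, mul_assoc, mul_assoc, mul_inv_cancel, mul_one]

variable {L' : ℕ} [NeZero L']

/-- ★ **Trivial decoders read like the base decoder — all lattice sizes.** [folklore] -/
theorem esPart_reading_eq_base' {g : GaugeConfig 3 L' G → ℝ} (hg : Measurable g) {C : ℝ} (hC : ∀ U, |g U| ≤ C)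
    (hGI : ∀ (k : Site 3 L' → G) (W : GaugeConfig 3 L' G), g (gaugeTransform k W) = g W)
    (hTI : ∀ (w : Site 3 L') (U : GaugeConfig 3 L' G), g (torusConfigShift w U) = g U)
    (R₁ : Finset (Edge 3 L')) (mbar : Site 3 L') (v : Site 3 (L' + 1))
    (hadm : ∀ j : Fin 3, (∃ m : ℕ, mbar j = (m : ZMod L') ∧ v j = -((m : ℕ) : ZMod (L' + 1)) ∧
            ∀ t : ℕ, t < m → ∀ e ∈ R₁, e.1 j = 1 + (t : ZMod L') → e.2 = j) ∨
          (mbar j = 0 ∧ shiftLinks (Pi.single j (1 : ZMod L') : Site 3 L') R₁ = R₁ ∧ ∀ e ∈ R₁, e.2 = j))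
    (U : GaugeConfig 3 (L' + 1) G) :
    esPart (haarProbability G) R₁ g (fun e : Edge 3 L' => thin L' (torusConfigShift v U) (e.1 - mbar, e.2)) =
      esPart (haarProbability G) R₁ g (thin L' U) := by
  by_cases hL : 2 ≤ L'
  · exact esPart_reading_eq_base hL hg hC hGI hTI R₁ mbar v hadm U
  · have hL1 : L' = 1 := by have := NeZero.one_le (n := L'); omega
    subst hL1
    exact esPart_reading_eq_base_one hg hGI R₁ mbar v hadm U

end Summit.QuantumFields.YangMills.Theorems.FlatTubeReduction.Decimation
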